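import Literature.AlgebraicGeometry.Motives.IntegralModelReductionMapLifting
import HarnessLib

/-!
# The reduction map commutes with point operations defined at three levels (generic ∕ integral ∕ special):
# `red (quotΩ y L) = quot (red y) (sp L)` ([SerreTate1968] §1; [Hartshorne1977] II.4.7 uniqueness in the valuative criterion)

Topic `Literature/AlgebraicGeometry/Motives`, namespace `Literature.AlgebraicGeometry.Motives.IntegralModel`.  THEOREMS only (no def, no
instance, no notation, no named fact, no `sorry`).  Cell `hodgecm-mathlib`, programme P6 («MOD»), the GENERIC (c2) CONSTRUCTOR LEMMA
(dealt F0P6c-plan (g0) 15:29:55Z ∕ LEAD M-13): the pointwise dictionary `PointDictionary` of the door P″ has two fields (c2)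
`red_quotΩ : red ∘ quotΩ = quot ∘ sp` and `red_translΩ : red ∘ translΩ = transl ∘ red` relating a MODULI OPERATION on points — defined at the
three levels `PΩ` (points of the generic fibre over `Ω = \overline{K_v}`), `P𝒪` (`R`-points of the proper model, `R ⊆ Ω` the valuation ring of
★ `geomReductionMap`) and `P₀` (`κ̄(v)`-points of the special fibre) and COMPATIBLE with restriction `P𝒪 → PΩ` and specialisation `P𝒪 → P₀`
(the ED.-3 datum fields D4∕D5 of `F0_P6a_ModuliDatum`) — to the reduction map `red = red_𝓨`.  This file proves that relation ONCE, over an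
ABSTRACT operation package, so that the ED.-4 constructors are one-liners.

## Mathematics

Let `𝓨` be a PROPER model of `Y` at `v` and `red : Y(Ω) → 𝓨_v(κ̄(v))` its reduction map (★ `geomReductionMap` = extend the `Ω`-point to an
`R`-point by the valuative criterion, then specialise).  The one fact used: **an `R`-point is determined by its generic point** (★
`extendPoint_restrictPoint` ∕ `extendPoint_eq_iff`), whence `red (e_𝓨 (z̃|_Ω)) = (z̃|_κ)` for every `R`-point `z̃` (★
`geomReductionMap_modelPointsEquiv_restrictPoint`).  Consequently, for an operation given at the three levels —
`qΩ` on generic «lines», `qR` on integral «lines», `q₀` on special «lines», with transports `cl` (closure, generic → integral) and `spR`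
(special fibre, integral → special) — the two compatibilities
(gen) `(qR (cl H))|_Ω = qΩ H` and (sp) `(qR H̃)|_κ = q₀ (spR H̃)` give **`red (qΩ H) = q₀ (spR (cl H))`** (§2); with one-element line types
this is the TRANSLATE form `red (TΩ y) = T₀ (red y)` (§1); composed with any downstairs reading `ℓ : P → Y(Ω)` (`red₀ := red ∘ ℓ`, DICT's
`red₀ = red_𝓨 ∘ ℓ_e`) and a downstairs operation intertwined by `ℓ`, it is DICT's (c2) verbatim shape (§3).

## Contents
* §0 `geomReductionMap_eq_reductionPoint_of_restrictPoint_eq` — `red y = (z̃|_κ)` for ANY `R`-point `z̃` with `z̃|_Ω = y` (the integral-point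
  form of ★ `geomReductionMap_modelPointsEquiv_restrictPoint`); `extendPoint_modelPointsEquiv_symm_eq_of_restrictPoint_eq` (uniqueness, named).
* §1 operations: `geomReductionMap_op_eq` (arbitrary integral witness), `geomReductionMap_op_eq_extendPoint` (witness `extendPoint`).
* §2 lines: `geomReductionMap_quot_eq`, `geomReductionMap_quot_eq_extendPoint`, family form `forall_geomReductionMap_quot_eq`.
* §3 downstairs readings `red₀ := red ∘ ℓ`: `geomReductionMap_comp_op_eq`, `geomReductionMap_comp_quot_eq`.

HC_CM is proved only modulo the printed citations until rung 0 closes; this file changes no count.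

## References
* [SerreTate1968] J.-P. Serre, J. Tate, *Good reduction of abelian varieties*, Ann. of Math. 88 (1968), §1 (the reduction map; reduction of
  isogenies).
* [Hartshorne1977] R. Hartshorne, *Algebraic Geometry*, II.4.7 (valuative criterion of properness: existence AND uniqueness of the extension).
-/

set_option autoImplicit false

noncomputable section

open CategoryTheory AlgebraicGeometry IsDedekindDomain IsDedekindDomain.HeightOneSpectrum
open scoped NumberField
open Literature.NumberTheory.EllipticCurves (genericFibre specGenericPoint)
open Literature.NumberTheory.GaloisRepresentations (closureValuationSubring)
open Literature.NumberTheory.DiophantineGeometry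

namespace Literature.AlgebraicGeometry.Motives

namespace IntegralModel

variable {K : Type} [Field K] [NumberField K] {v : HeightOneSpectrum (𝓞 K)} {Y : SchemeOver K}
  (𝓨 : IntegralModel (valuationSubringAtPrime K v) K Y) [IsProper 𝓨.total.hom]

/-! ### §0 The reduction of an `Ω`-point through ANY integral witness -/

/-- **Uniqueness of the integral extension, named**: an `R`-point `z̃` of the proper model whose generic point is `e_𝓨⁻¹ y` IS
`extendPoint (e_𝓨⁻¹ y)` (★ `extendPoint_eq_iff`). [cite: Hartshorne1977, II.4.7] -/
theorem extendPoint_modelPointsEquiv_symm_eq_of_restrictPoint_eq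
    (z : specValuationSubring (closureValuationSubring (v.adicCompletion K)) (toClosureValuationSubring v) ⟶ 𝓨.total)
    (y : AlgPoints Y (AlgebraicClosure (v.adicCompletion K)))
    (h : restrictPoint (closureValuationSubring (v.adicCompletion K)) (toClosureValuationSubring v) 𝓨.total z = 𝓨.modelPointsEquiv.symm y) :
    extendPoint (closureValuationSubring (v.adicCompletion K)) (toClosureValuationSubring v) 𝓨.total (𝓨.modelPointsEquiv.symm y) = z :=
  (extendPoint_eq_iff _ _ 𝓨.total _ z).mpr h

/-- **The reduction of `y` through ANY integral witness**: if the `R`-point `z̃` has generic point `e_𝓨⁻¹ y`, then `red_𝓨 y` is the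
specialisation `reductionPoint (ι_κ ≫ z̃)` — the integral-point form of ★ `geomReductionMap_modelPointsEquiv_restrictPoint`.
[cite: SerreTate1968, §1] [cite: Hartshorne1977, II.4.7] -/
theorem geomReductionMap_eq_reductionPoint_of_restrictPoint_eq
    (z : specValuationSubring (closureValuationSubring (v.adicCompletion K)) (toClosureValuationSubring v) ⟶ 𝓨.total)
    (y : AlgPoints Y (AlgebraicClosure (v.adicCompletion K)))
    (h : restrictPoint (closureValuationSubring (v.adicCompletion K)) (toClosureValuationSubring v) 𝓨.total z = 𝓨.modelPointsEquiv.symm y) :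
    𝓨.geomReductionMap y =
      𝓨.reductionPoint
        (specRingHomι (closureValuationSubring (v.adicCompletion K)) (toClosureValuationSubring v)
            (IsLocalRing.residue (closureValuationSubring (v.adicCompletion K))) ≫ z) := by
  have hy : y = 𝓨.modelPointsEquiv
      (restrictPoint (closureValuationSubring (v.adicCompletion K)) (toClosureValuationSubring v) 𝓨.total z) := by
    rw [h, Equiv.apply_symm_apply]
  rw [hy]
  exact 𝓨.geomReductionMap_modelPointsEquiv_restrictPoint z

/-! ### §1 Operations at three levels (the TRANSLATE shape `red ∘ TΩ = T₀ ∘ red`) -/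

section Operation

variable {TΩ : AlgPoints Y (AlgebraicClosure (v.adicCompletion K)) → AlgPoints Y (AlgebraicClosure (v.adicCompletion K))}
  {TR : (specValuationSubring (closureValuationSubring (v.adicCompletion K)) (toClosureValuationSubring v) ⟶ 𝓨.total) →
    (specValuationSubring (closureValuationSubring (v.adicCompletion K)) (toClosureValuationSubring v) ⟶ 𝓨.total)}
  {T₀ : AlgPoints 𝓨.reductionAt (geomResidueField v) → AlgPoints 𝓨.reductionAt (geomResidueField v)}

/-- **`red (TΩ y) = T₀ (red y)` for an operation given at the three levels** (generic `TΩ`, integral `TR`, special `T₀`): if an integral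
witness `z̃` of `y` (`z̃|_Ω = e_𝓨⁻¹ y`) has `(TR z̃)|_Ω = e_𝓨⁻¹ (TΩ y)` (gen) and `(TR z̃)|_κ = T₀ (z̃|_κ)` (sp), then the reduction map
intertwines `TΩ` and `T₀` at `y` — DICT's (c2) `red_translΩ` shape (`⟨ϖ⟩` as a moduli operation on points).
[cite: SerreTate1968, §1] [cite: Hartshorne1977, II.4.7] -/
theorem geomReductionMap_op_eq (y : AlgPoints Y (AlgebraicClosure (v.adicCompletion K)))
    (z : specValuationSubring (closureValuationSubring (v.adicCompletion K)) (toClosureValuationSubring v) ⟶ 𝓨.total)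
    (hz : restrictPoint (closureValuationSubring (v.adicCompletion K)) (toClosureValuationSubring v) 𝓨.total z = 𝓨.modelPointsEquiv.symm y)
    (hgen : restrictPoint (closureValuationSubring (v.adicCompletion K)) (toClosureValuationSubring v) 𝓨.total (TR z) =
      𝓨.modelPointsEquiv.symm (TΩ y))
    (hsp : 𝓨.reductionPoint
        (specRingHomι (closureValuationSubring (v.adicCompletion K)) (toClosureValuationSubring v)
            (IsLocalRing.residue (closureValuationSubring (v.adicCompletion K))) ≫ TR z) =
      T₀ (𝓨.reductionPoint
        (specRingHomι (closureValuationSubring (v.adicCompletion K)) (toClosureValuationSubring v)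
            (IsLocalRing.residue (closureValuationSubring (v.adicCompletion K))) ≫ z))) :
    𝓨.geomReductionMap (TΩ y) = T₀ (𝓨.geomReductionMap y) := by
  rw [𝓨.geomReductionMap_eq_reductionPoint_of_restrictPoint_eq (TR z) (TΩ y) hgen, hsp,
    ← 𝓨.geomReductionMap_eq_reductionPoint_of_restrictPoint_eq z y hz]

/-- The same with the CANONICAL witness `z̃ := extendPoint (e_𝓨⁻¹ y)` (★ `restrictPoint_extendPoint`).
[cite: SerreTate1968, §1] [cite: Hartshorne1977, II.4.7] -/
theorem geomReductionMap_op_eq_extendPoint (y : AlgPoints Y (AlgebraicClosure (v.adicCompletion K)))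
    (hgen : restrictPoint (closureValuationSubring (v.adicCompletion K)) (toClosureValuationSubring v) 𝓨.total
        (TR (extendPoint (closureValuationSubring (v.adicCompletion K)) (toClosureValuationSubring v) 𝓨.total (𝓨.modelPointsEquiv.symm y))) =
      𝓨.modelPointsEquiv.symm (TΩ y))
    (hsp : 𝓨.reductionPoint
        (specRingHomι (closureValuationSubring (v.adicCompletion K)) (toClosureValuationSubring v)
            (IsLocalRing.residue (closureValuationSubring (v.adicCompletion K))) ≫
          TR (extendPoint (closureValuationSubring (v.adicCompletion K)) (toClosureValuationSubring v) 𝓨.total (𝓨.modelPointsEquiv.symm y))) =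
      T₀ (𝓨.reductionPoint
        (specRingHomι (closureValuationSubring (v.adicCompletion K)) (toClosureValuationSubring v)
            (IsLocalRing.residue (closureValuationSubring (v.adicCompletion K))) ≫
          extendPoint (closureValuationSubring (v.adicCompletion K)) (toClosureValuationSubring v) 𝓨.total (𝓨.modelPointsEquiv.symm y)))) :
    𝓨.geomReductionMap (TΩ y) = T₀ (𝓨.geomReductionMap y) :=
  𝓨.geomReductionMap_op_eq y _ (restrictPoint_extendPoint _ _ 𝓨.total _) hgen hsp

end Operation

/-! ### §2 Operations on «lines» at three levels (the QUOTIENT shape `red (quotΩ y H) = quot (red y) (sp H)`) -/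

section Lines

variable {ΛΩ ΛR Λ₀ : Type*}
  (qΩ : ΛΩ → AlgPoints Y (AlgebraicClosure (v.adicCompletion K)))
  (qR : ΛR → (specValuationSubring (closureValuationSubring (v.adicCompletion K)) (toClosureValuationSubring v) ⟶ 𝓨.total))
  (q₀ : Λ₀ → AlgPoints 𝓨.reductionAt (geomResidueField v))
  (cl : ΛΩ → ΛR) (spR : ΛR → Λ₀)

/-- **`red (qΩ H) = q₀ (spR (cl H))` — the (c2) constructor lemma.**  An operation on «lines» given at the three levels (`qΩ` on generic
lines, `qR` on integral lines, `q₀` on special lines; in DICT: `y ↦ quotΩ y H`, its integral extension, `x̄ ↦ quot x̄ H̄`) with transports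
`cl` («closure of a generic line over the valuation ring», ★ (o-c2g)) and `spR` («special fibre of an integral line»), such that the integral
operation RESTRICTS to the generic one (`hgen`, datum field D5 `quot_natural_gen`) and SPECIALISES to the special one (`hsp`, D5
`quot_natural_sp`), commutes with the reduction map: `red_𝓨 (qΩ H) = q₀ (spR (cl H))`.  With `sp := spR ∘ cl` this is `red ∘ quotΩ = quot ∘ sp`.
[cite: SerreTate1968, §1] [cite: Hartshorne1977, II.4.7] -/
theorem geomReductionMap_quot_eq (H : ΛΩ)
    (hgen : restrictPoint (closureValuationSubring (v.adicCompletion K)) (toClosureValuationSubring v) 𝓨.total (qR (cl H)) =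
      𝓨.modelPointsEquiv.symm (qΩ H))
    (hsp : 𝓨.reductionPoint
        (specRingHomι (closureValuationSubring (v.adicCompletion K)) (toClosureValuationSubring v)
            (IsLocalRing.residue (closureValuationSubring (v.adicCompletion K))) ≫ qR (cl H)) = q₀ (spR (cl H))) :
    𝓨.geomReductionMap (qΩ H) = q₀ (spR (cl H)) := by
  rw [𝓨.geomReductionMap_eq_reductionPoint_of_restrictPoint_eq (qR (cl H)) (qΩ H) hgen, hsp]

/-- The witness-free form: the integral operation on the closure IS the extension of the generic operation (`hgen`), so its specialisation is
read off `extendPoint`. [cite: Hartshorne1977, II.4.7] -/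
theorem geomReductionMap_quot_eq_extendPoint (H : ΛΩ)
    (hgen : restrictPoint (closureValuationSubring (v.adicCompletion K)) (toClosureValuationSubring v) 𝓨.total (qR (cl H)) =
      𝓨.modelPointsEquiv.symm (qΩ H))
    (hsp : 𝓨.reductionPoint
        (specRingHomι (closureValuationSubring (v.adicCompletion K)) (toClosureValuationSubring v)
            (IsLocalRing.residue (closureValuationSubring (v.adicCompletion K))) ≫ qR (cl H)) = q₀ (spR (cl H))) :
    extendPoint (closureValuationSubring (v.adicCompletion K)) (toClosureValuationSubring v) 𝓨.total (𝓨.modelPointsEquiv.symm (qΩ H)) =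
        qR (cl H) ∧
      𝓨.geomReductionMap (qΩ H) = q₀ (spR (cl H)) :=
  ⟨𝓨.extendPoint_modelPointsEquiv_symm_eq_of_restrictPoint_eq (qR (cl H)) (qΩ H) hgen, 𝓨.geomReductionMap_quot_eq qΩ qR q₀ cl spR H hgen hsp⟩

/-- **Family form** (the shape of DICT's field `red_quotΩ`): if the integral operation restricts to the generic one on every closure (D5 gen)
and specialises to the special one on EVERY integral line (D5 sp), then `∀ H, red (qΩ H) = q₀ (spR (cl H))`.
[cite: SerreTate1968, §1] [cite: Hartshorne1977, II.4.7] -/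
theorem forall_geomReductionMap_quot_eq
    (hgen : ∀ H : ΛΩ, restrictPoint (closureValuationSubring (v.adicCompletion K)) (toClosureValuationSubring v) 𝓨.total (qR (cl H)) =
      𝓨.modelPointsEquiv.symm (qΩ H))
    (hsp : ∀ H' : ΛR, 𝓨.reductionPoint
        (specRingHomι (closureValuationSubring (v.adicCompletion K)) (toClosureValuationSubring v)
            (IsLocalRing.residue (closureValuationSubring (v.adicCompletion K))) ≫ qR H') = q₀ (spR H')) :
    ∀ H : ΛΩ, 𝓨.geomReductionMap (qΩ H) = q₀ (spR (cl H)) :=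
  fun H => 𝓨.geomReductionMap_quot_eq qΩ qR q₀ cl spR H (hgen H) (hsp (cl H))

end Lines

/-! ### §3 Downstairs readings `red₀ := red_𝓨 ∘ ℓ` (DICT's `red₀ = red_𝓨 ∘ ℓ_e`) -/

section Downstairs

variable {P : Type*} (ℓ : P → AlgPoints Y (AlgebraicClosure (v.adicCompletion K)))

/-- **`red₀ (TD x) = T₀ (red₀ x)`** for a downstairs operation `TD` on `P` intertwined by the reading `ℓ` with an operation at the three levels
(`ℓ (TD x) = TΩ (ℓ x)`, e.g. `ℓ = ℓ_e ∘ u` and `TD` a Hecke translate read through ★ `map_thickening_map_thickeningLift`).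
[cite: SerreTate1968, §1] [cite: Hartshorne1977, II.4.7] -/
theorem geomReductionMap_comp_op_eq
    {TD : P → P} {TΩ : AlgPoints Y (AlgebraicClosure (v.adicCompletion K)) → AlgPoints Y (AlgebraicClosure (v.adicCompletion K))}
    {TR : (specValuationSubring (closureValuationSubring (v.adicCompletion K)) (toClosureValuationSubring v) ⟶ 𝓨.total) →
      (specValuationSubring (closureValuationSubring (v.adicCompletion K)) (toClosureValuationSubring v) ⟶ 𝓨.total)}
    {T₀ : AlgPoints 𝓨.reductionAt (geomResidueField v) → AlgPoints 𝓨.reductionAt (geomResidueField v)}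
    (x : P) (hℓ : ℓ (TD x) = TΩ (ℓ x))
    (z : specValuationSubring (closureValuationSubring (v.adicCompletion K)) (toClosureValuationSubring v) ⟶ 𝓨.total)
    (hz : restrictPoint (closureValuationSubring (v.adicCompletion K)) (toClosureValuationSubring v) 𝓨.total z = 𝓨.modelPointsEquiv.symm (ℓ x))
    (hgen : restrictPoint (closureValuationSubring (v.adicCompletion K)) (toClosureValuationSubring v) 𝓨.total (TR z) =
      𝓨.modelPointsEquiv.symm (TΩ (ℓ x)))
    (hsp : 𝓨.reductionPoint
        (specRingHomι (closureValuationSubring (v.adicCompletion K)) (toClosureValuationSubring v)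
            (IsLocalRing.residue (closureValuationSubring (v.adicCompletion K))) ≫ TR z) =
      T₀ (𝓨.reductionPoint
        (specRingHomι (closureValuationSubring (v.adicCompletion K)) (toClosureValuationSubring v)
            (IsLocalRing.residue (closureValuationSubring (v.adicCompletion K))) ≫ z))) :
    𝓨.geomReductionMap (ℓ (TD x)) = T₀ (𝓨.geomReductionMap (ℓ x)) := by
  rw [hℓ]
  exact 𝓨.geomReductionMap_op_eq (ℓ x) z hz hgen hsp

/-- **`red₀ (quotD x L) = q₀ (spR (cl (lineUp L)))`** — DICT's (c2) `red_quotΩ` verbatim shape: a downstairs quotient `quotD x L ∈ P` read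
through `ℓ` as a generic line operation (`ℓ (quotD x L) = qΩ (lineUp L)`, `lineUp` = the line of `ℓ x` attached to `L`), with the
three-level compatibilities of §2. [cite: SerreTate1968, §1] [cite: Hartshorne1977, II.4.7] -/
theorem geomReductionMap_comp_quot_eq {ΛD ΛΩ ΛR Λ₀ : Type*}
    (quotD : ΛD → P) (lineUp : ΛD → ΛΩ)
    (qΩ : ΛΩ → AlgPoints Y (AlgebraicClosure (v.adicCompletion K)))
    (qR : ΛR → (specValuationSubring (closureValuationSubring (v.adicCompletion K)) (toClosureValuationSubring v) ⟶ 𝓨.total))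
    (q₀ : Λ₀ → AlgPoints 𝓨.reductionAt (geomResidueField v))
    (cl : ΛΩ → ΛR) (spR : ΛR → Λ₀) (L : ΛD)
    (hℓ : ℓ (quotD L) = qΩ (lineUp L))
    (hgen : restrictPoint (closureValuationSubring (v.adicCompletion K)) (toClosureValuationSubring v) 𝓨.total (qR (cl (lineUp L))) =
      𝓨.modelPointsEquiv.symm (qΩ (lineUp L)))
    (hsp : 𝓨.reductionPoint
        (specRingHomι (closureValuationSubring (v.adicCompletion K)) (toClosureValuationSubring v)
            (IsLocalRing.residue (closureValuationSubring (v.adicCompletion K))) ≫ qR (cl (lineUp L))) = q₀ (spR (cl (lineUp L)))) :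
    𝓨.geomReductionMap (ℓ (quotD L)) = q₀ (spR (cl (lineUp L))) := by
  rw [hℓ]
  exact 𝓨.geomReductionMap_quot_eq qΩ qR q₀ cl spR (lineUp L) hgen hsp

end Downstairs

end IntegralModel

end Literature.AlgebraicGeometry.Motives

end
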